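import Literature.Probability.Percolation.MarkedLoopHolomorphy
import HarnessLib

/-!
# The tripod relations are linearly independent (one per picture, up to rotation)

Topic `Literature/Probability/Percolation`; generic-`k` layer, a rider on `MarkedLoopHolomorphy.lean` (the TRIPOD LAW `TripodLaw`,
tripod pictures `TripodPicture α β γ L₀`, `withPair`). For every odd number `k = 2l+1` of boundary disorders the tripod law of
Khristoforov–Smirnov's Lemma 4 (generic form, `holomorphicW_of_tripodLaw`) is a homogeneous linear system on class weights
`wt : Fin k → Finset (Fin k × Fin k) → ℂ`, one relation per tripod picture `(α, β, γ; L₀)`: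
`wt α (L₀+βγ) + τ·wt β (L₀+γα) + τ²·wt γ (L₀+αβ) = 0` (`tripodLaw_iff_tripodRel`). The three rotations of a picture give
proportional relations; indexing pictures up to rotation by `α < β < γ` (`Pic k`), THE RELATION VECTORS ARE LINEARLY INDEPENDENT
over `ℂ` (`linearIndependent_relVec`).

## Content
* `depth j L` — the number of ordered pairs of `L` enclosing `j`; `depth_eq_of_picture` (planarity of a picture makes the depths of
  the three apexes in `L₀` equal), `depth_patterns` (in the relation of `lo < mid < hi` the MID pattern `(mid; L₀+{hi,lo})` has depth
  one more than the LO and HI patterns);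
* `midPattern_injective` — the mid pattern determines the picture (`{lo, hi}` is the innermost chord of `L₀+{lo,hi}` around `mid`);
* `Pic k`, `Pic.relVec`, ★ `linearIndependent_relVec` — a vanishing combination, evaluated at the mid pattern of a picture of maximal
  depth in its support, isolates that picture's coefficient (times `τ ≠ 0`).

## Remarks (bookkeeping, not used by the proofs)
* Consequence (counted outside the tree): for `k = 2l+1` the pictures up to rotation number `C(2l+1, l−1)` and the non-crossing
  (partner, relation) patterns `C(2l+1, l)`, so the solution space of the tripod law on pattern weights has dimension
  `C(2l+1, l) − C(2l+1, l−1) = C_{l+1}` (Catalan: 2, 5, 14, 42 for k = 3, 5, 7, 9 — the lane's exact tables). This is the classical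
  ballot number = the number of non-crossing perfect matchings of `k+1` points; it coincides with the dimension of the continuum
  solution space of Flores–Kleban for `k+1` points. CONSISTENCY REMARK ONLY: nothing about convergence of the lattice observables
  to continuum objects is claimed or suggested here.
* The unitriangularity-by-nesting device is standard for link-pattern bases (Kytölä–Peltola 2016; Di Francesco–Golinelli–Guitter
  1997); the present instance (relations indexed by one 3-block of a non-crossing structure) is written out here for the lane.

## Editions / sequels (provenance)
* ed.1 (p376212, 2026-08-24): the file as above. ed.2 (this edition): this «Editions / sequels» paragraph only — no declaration changed.
* Status of the first Remark, now in the lane's kernel texts: the COUNT `dim + #pictures = #patterns` is the theorem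
  `finrank_solW_add_card_pic` and `dim = #NCMatching (k+1)` is `finrank_solW_eq_card_ncMatching` of the sequel `MarkedLoopTripodBasis`
  («TRIPOD-SOLVED»: all solutions of the tripod law, the depth recursion with free data on the outermost patterns, via this file's `depth`,
  `Pic`, `midPat_injective`); the Catalan VALUE stays a remark. Further sequels: `MarkedLoopRotation` (p379007: pictures and the law transport
  under cyclic symmetries of the marks, `TripodPicture.map`), `MarkedLoopTripodCuts` (the basis adapted to every cut; boundary values on all
  arcs), `MarkedLoopTripodCharacter` (the relation map `ℂ^Pat → ℂ^Pic` built on `Pic.loPat/midPat/hiPat` is an equivariant surjection with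
  kernel the solution space; for `3 ∤ k` the rotation has vanishing character on it and `k ∣ #NCMatching (k+1)`).

## References
* M. Khristoforov, S. Smirnov, *Percolation and O(1) loop model*, arXiv:2111.15612 (2021), §1.2 (arXiv v1 p. 2), §2 Lemma 4 and
  Fig. 3 (p. 4).
* B. Bollobás, O. Riordan, *Percolation*, CUP (2006), Ch. 7 §7.2.2 (pp. 191–195) (marked discrete domains).
-/

open Finset

namespace Literature.Probability.Percolation.MarkedLoops

open Literature.Probability.Percolation.FivePoint (tau)

section TripodRank

variable {nm : ℕ}

/-- the DEPTH of a corner `j` under a relation `L`: the number of ordered pairs `(c, d) ∈ L` with `c < j < d`.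
[cite: KhristoforovSmirnov2021, §1.2 (arXiv v1 p. 2: the link pattern)] -/
def depth (j : Fin nm) (L : Finset (Fin nm × Fin nm)) : ℕ := #(L.filter fun cd => cd.1 < j ∧ j < cd.2)

/-- the relation vector of a tripod picture, as a function on (partner, relation) pairs.
[cite: KhristoforovSmirnov2021, §2 Lemma 4, proof and Fig. 3 (p. 4)] -/
noncomputable def tripodRel (α β γ : Fin nm) (L₀ : Finset (Fin nm × Fin nm)) : (Fin nm × Finset (Fin nm × Fin nm)) → ℂ :=
  fun p => (if p = (α, withPair L₀ β γ) then 1 else 0) + (if p = (β, withPair L₀ γ α) then tau else 0) +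
    (if p = (γ, withPair L₀ α β) then tau ^ 2 else 0)

/-- the tripod law is the vanishing of every pairing with a relation vector (bookkeeping).
[cite: KhristoforovSmirnov2021, §2 Lemma 4, proof and Fig. 3 (p. 4)] -/
theorem tripodLaw_iff_tripodRel (wt : Fin nm → Finset (Fin nm × Fin nm) → ℂ) :
    TripodLaw wt ↔ ∀ (α β γ : Fin nm) (L₀ : Finset (Fin nm × Fin nm)), TripodPicture α β γ L₀ →
      wt α (withPair L₀ β γ) + tau * wt β (withPair L₀ γ α) + tau ^ 2 * wt γ (withPair L₀ α β) = 0 := Iff.rfl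

end TripodRank

section TripodRankLemmas

variable {nm : ℕ}

/-- depth after adding a pair that encloses `j` in the orientation `(a, b)` and not in `(b, a)`. [folklore] -/
private theorem depth_withPair_of_enclose {j a b : Fin nm} {L : Finset (Fin nm × Fin nm)} (hab : (a, b) ∉ L) (h1 : a < j ∧ j < b) :
    depth j (withPair L a b) = depth j L + 1 := by
  classical
  unfold depth withPair
  rw [Finset.filter_insert, if_pos h1, Finset.filter_insert, if_neg (fun h : b < j ∧ j < a => lt_asymm (h1.1.trans h1.2) (h.1.trans h.2)),
    Finset.card_insert_of_notMem (fun h => hab (Finset.mem_filter.1 h).1)]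

/-- depth after adding a pair none of whose orientations encloses `j`. [folklore] -/
private theorem depth_withPair_of_not_enclose {j a b : Fin nm} {L : Finset (Fin nm × Fin nm)} (h1 : ¬ (a < j ∧ j < b)) (h2 : ¬ (b < j ∧ j < a)) :
    depth j (withPair L a b) = depth j L := by
  classical
  unfold depth withPair
  rw [Finset.filter_insert, if_neg h1, Finset.filter_insert, if_neg h2]

/-- **planarity makes the depths of the three apexes in `L₀` equal** (a pair of `L₀` encloses one apex iff it encloses all three).
[cite: KhristoforovSmirnov2021, §1.2 (arXiv v1 p. 2: «disjoint paths»)] -/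
theorem depth_eq_of_picture {α β γ : Fin nm} {L₀ : Finset (Fin nm × Fin nm)} (hP : TripodPicture α β γ L₀) (hαβ : α < β) (hβγ : β < γ) :
    depth α L₀ = depth β L₀ ∧ depth γ L₀ = depth β L₀ := by
  classical
  have chordαβ : (α, β) ∈ withPair (withPair (withPair L₀ α β) β γ) γ α := by rw [mem_withPair, mem_withPair, mem_withPair]; tauto
  have chordβγ : (β, γ) ∈ withPair (withPair (withPair L₀ α β) β γ) γ α := by rw [mem_withPair, mem_withPair, mem_withPair]; tauto
  have off := hP.off
  -- a pair of L₀ enclosing β encloses α and γ, and conversely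
  have key : ∀ c d : Fin nm, (c, d) ∈ L₀ → ((c < α ∧ α < d) ↔ (c < β ∧ β < d)) ∧ ((c < γ ∧ γ < d) ↔ (c < β ∧ β < d)) := by
    intro c d hcd
    obtain ⟨hcα, hcβ, hcγ⟩ := off c d hcd
    obtain ⟨hdα, hdβ, hdγ⟩ := off d c (hP.symm c d hcd)
    have p1 := hP.planar α c β d chordαβ hcd
    have p2 := hP.planar α d β c chordαβ (hP.symm c d hcd)
    have p3 := hP.planar β c γ d chordβγ hcd
    have p4 := hP.planar β d γ c chordβγ (hP.symm c d hcd)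
    unfold CcwQuad at p1 p2 p3 p4
    have := hαβ; have := hβγ
    have nca : c ≠ α := hcα; have ncb : c ≠ β := hcβ; have ncg : c ≠ γ := hcγ
    have nda : d ≠ α := hdα; have ndb : d ≠ β := hdβ; have ndg : d ≠ γ := hdγ
    rw [Fin.lt_def, Fin.lt_def] at *
    simp only [Fin.lt_def] at p1 p2 p3 p4
    have vca := Fin.val_ne_of_ne nca; have vcb := Fin.val_ne_of_ne ncb; have vcg := Fin.val_ne_of_ne ncg
    have vda := Fin.val_ne_of_ne nda; have vdb := Fin.val_ne_of_ne ndb; have vdg := Fin.val_ne_of_ne ndg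
    constructor <;> constructor <;> intro h <;> omega
  unfold depth
  constructor
  · congr 1; exact Finset.filter_congr fun cd hcd => (key cd.1 cd.2 hcd).1
  · congr 1; exact Finset.filter_congr fun cd hcd => (key cd.1 cd.2 hcd).2

/-- **the three depths of a picture**: with `α < β < γ`, the pattern `(β; L₀+γα)` is one deeper than `(α; L₀+βγ)` and `(γ; L₀+αβ)`.
[cite: KhristoforovSmirnov2021, §2 Lemma 4, proof and Fig. 3 (p. 4)] -/
theorem depth_patterns {α β γ : Fin nm} {L₀ : Finset (Fin nm × Fin nm)} (hP : TripodPicture α β γ L₀) (hαβ : α < β) (hβγ : β < γ) :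
    depth β (withPair L₀ γ α) = depth β L₀ + 1 ∧ depth α (withPair L₀ β γ) = depth β L₀ ∧ depth γ (withPair L₀ α β) = depth β L₀ := by
  obtain ⟨hα, hγ⟩ := depth_eq_of_picture hP hαβ hβγ
  have hαγ : α < γ := hαβ.trans hβγ
  have nγα : (γ, α) ∉ L₀ := fun h => (hP.off γ α h).2.2 rfl
  have nαγ : (α, γ) ∉ L₀ := fun h => (hP.off α γ h).1 rfl
  refine ⟨?_, ?_, ?_⟩
  · -- withPair L₀ γ α = insert (γ,α) (insert (α,γ) L₀): the orientation (α, γ) encloses β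
    unfold withPair depth
    classical
    rw [Finset.filter_insert, if_neg (fun h : γ < β ∧ β < α => lt_asymm hβγ h.1), Finset.filter_insert, if_pos ⟨hαβ, hβγ⟩,
      Finset.card_insert_of_notMem (fun h => nαγ (Finset.mem_filter.1 h).1)]
  · rw [depth_withPair_of_not_enclose (fun h => lt_asymm hαβ h.1) (fun h => lt_asymm hαγ h.1), hα]
  · rw [depth_withPair_of_not_enclose (fun h => lt_asymm hβγ h.2) (fun h => lt_asymm hαγ h.2), hγ]

/-- **the mid pattern determines the picture**: `(α < β < γ; L₀) ↦ (β; L₀ + {γ, α})` is injective on tripod pictures (the chord `{α, γ}` is the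
innermost chord around `β`). [cite: KhristoforovSmirnov2021, §1.2 (arXiv v1 p. 2: «disjoint paths»)] -/
theorem midPattern_injective {α β γ α' γ' : Fin nm} {L₀ L₀' : Finset (Fin nm × Fin nm)} (hP : TripodPicture α β γ L₀)
    (hP' : TripodPicture α' β γ' L₀') (hαβ : α < β) (hβγ : β < γ) (hαβ' : α' < β) (hβγ' : β < γ')
    (h : withPair L₀ γ α = withPair L₀' γ' α') : α = α' ∧ γ = γ' ∧ L₀ = L₀' := by
  classical
  -- the chords of each picture
  have chordαβ : (α, β) ∈ withPair (withPair (withPair L₀ α β) β γ) γ α := by rw [mem_withPair, mem_withPair, mem_withPair]; tauto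
  have chordβγ : (β, γ) ∈ withPair (withPair (withPair L₀ α β) β γ) γ α := by rw [mem_withPair, mem_withPair, mem_withPair]; tauto
  have chordαβ' : (α', β) ∈ withPair (withPair (withPair L₀' α' β) β γ') γ' α' := by rw [mem_withPair, mem_withPair, mem_withPair]; tauto
  have chordβγ' : (β, γ') ∈ withPair (withPair (withPair L₀' α' β) β γ') γ' α' := by rw [mem_withPair, mem_withPair, mem_withPair]; tauto
  have hαγ : α < γ := hαβ.trans hβγ
  have hαγ' : α' < γ' := hαβ'.trans hβγ'
  -- Step 1: the chords {α,γ} and {α',γ'} coincide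
  have hchord : α = α' ∧ γ = γ' := by
    by_contra hne
    -- (α', γ') ∈ L₀ and (α, γ) ∈ L₀'
    have h1 : (α', γ') ∈ withPair L₀ γ α := by rw [h, mem_withPair]; exact Or.inr (Or.inl ⟨rfl, rfl⟩)
    rw [mem_withPair] at h1
    have hin : (α', γ') ∈ L₀ := by
      rcases h1 with ⟨e1, e2⟩ | ⟨e1, e2⟩ | h1
      · exfalso; rw [e1, e2] at hαγ'; exact lt_asymm hαγ hαγ'
      · exact absurd ⟨e1.symm, e2.symm⟩ hne
      · exact h1
    have h2 : (α, γ) ∈ withPair L₀' γ' α' := by rw [← h, mem_withPair]; exact Or.inr (Or.inl ⟨rfl, rfl⟩)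
    rw [mem_withPair] at h2
    have hin' : (α, γ) ∈ L₀' := by
      rcases h2 with ⟨e1, e2⟩ | ⟨e1, e2⟩ | h2
      · exfalso; rw [e1, e2] at hαγ; exact lt_asymm hαγ' hαγ
      · exact absurd ⟨e1, e2⟩ hne
      · exact h2
    -- symmetric orientations
    have hin2 : (γ', α') ∈ L₀ := hP.symm _ _ hin
    have hin2' : (γ, α) ∈ L₀' := hP'.symm _ _ hin'
    -- off: the L₀-pair (α',γ') avoids α, β, γ; the L₀'-pair (α,γ) avoids α', β, γ'
    obtain ⟨nα'α, nα'β, nα'γ⟩ := hP.off _ _ hin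
    obtain ⟨nγ'α, nγ'β, nγ'γ⟩ := hP.off _ _ hin2
    obtain ⟨nαα', -, nαγ'⟩ := hP'.off _ _ hin'
    obtain ⟨nγα', -, nγγ'⟩ := hP'.off _ _ hin2'
    -- planarity of P against (α',γ') and of P' against (α,γ)
    have p1 := hP.planar α α' β γ' chordαβ hin
    have p2 := hP.planar β γ' γ α' chordβγ hin2
    have p3 := hP'.planar α' α β γ chordαβ' hin'
    have p4 := hP'.planar β γ γ' α chordβγ' hin2'
    unfold CcwQuad at p1 p2 p3 p4
    simp only [Fin.lt_def] at p1 p2 p3 p4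
    rw [Fin.lt_def] at hαβ hβγ hαβ' hβγ' hαγ hαγ'
    have v1 := Fin.val_ne_of_ne nα'α; have v2 := Fin.val_ne_of_ne nα'β; have v3 := Fin.val_ne_of_ne nα'γ
    have v4 := Fin.val_ne_of_ne nγ'α; have v5 := Fin.val_ne_of_ne nγ'β; have v6 := Fin.val_ne_of_ne nγ'γ
    omega
  obtain ⟨rfl, rfl⟩ := hchord
  refine ⟨rfl, rfl, ?_⟩
  -- Step 2: L₀ = L₀' (remove the common chord)
  have nγα : (γ, α) ∉ L₀ := fun h => (hP.off γ α h).2.2 rfl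
  have nαγ : (α, γ) ∉ L₀ := fun h => (hP.off α γ h).1 rfl
  have nγα' : (γ, α) ∉ L₀' := fun h => (hP'.off γ α h).2.2 rfl
  have nαγ' : (α, γ) ∉ L₀' := fun h => (hP'.off α γ h).1 rfl
  ext ⟨c, d⟩
  have e1 : (c, d) ∈ withPair L₀ γ α ↔ (c, d) ∈ withPair L₀' γ α := by rw [h]
  rw [mem_withPair, mem_withPair] at e1
  constructor
  · intro hcd
    have hne1 : ¬ (c = γ ∧ d = α) := fun e => nγα (by rw [← e.1, ← e.2]; exact hcd)
    have hne2 : ¬ (c = α ∧ d = γ) := fun e => nαγ (by rw [← e.1, ← e.2]; exact hcd)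
    rcases e1.1 (Or.inr (Or.inr hcd)) with e | e | e
    · exact absurd e hne1
    · exact absurd e hne2
    · exact e
  · intro hcd
    have hne1 : ¬ (c = γ ∧ d = α) := fun e => nγα' (by rw [← e.1, ← e.2]; exact hcd)
    have hne2 : ¬ (c = α ∧ d = γ) := fun e => nαγ' (by rw [← e.1, ← e.2]; exact hcd)
    rcases e1.2 (Or.inr (Or.inr hcd)) with e | e | e
    · exact absurd e hne1
    · exact absurd e hne2
    · exact e

end TripodRankLemmas

section TripodRankMain

variable {nm : ℕ}

/-- **tripod pictures up to rotation**: increasing triples `α < β < γ` carrying a tripod picture with relation `L₀`.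
[cite: KhristoforovSmirnov2021, §2 Lemma 4, proof and Fig. 3 (p. 4)] -/
def Pic (nm : ℕ) : Type :=
  {p : (Fin nm × Fin nm × Fin nm) × Finset (Fin nm × Fin nm) // p.1.1 < p.1.2.1 ∧ p.1.2.1 < p.1.2.2 ∧ TripodPicture p.1.1 p.1.2.1 p.1.2.2 p.2}

namespace Pic

variable (P : Pic nm)

/-- the apexes and the relation of a picture. [cite: KhristoforovSmirnov2021, §2 Lemma 4, proof and Fig. 3 (arXiv v1 p. 4)] -/
def α : Fin nm := P.1.1.1
/-- Auxiliary. [cite: KhristoforovSmirnov2021, §2 Lemma 4, proof and Fig. 3 (arXiv v1 p. 4)] -/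
def β : Fin nm := P.1.1.2.1
/-- Auxiliary. [cite: KhristoforovSmirnov2021, §2 Lemma 4, proof and Fig. 3 (arXiv v1 p. 4)] -/
def γ : Fin nm := P.1.1.2.2
/-- Auxiliary. [cite: KhristoforovSmirnov2021, §2 Lemma 4, proof and Fig. 3 (arXiv v1 p. 4)] -/
def L₀ : Finset (Fin nm × Fin nm) := P.1.2
/-- the three patterns of the relation. [cite: KhristoforovSmirnov2021, §2 Lemma 4, proof and Fig. 3 (arXiv v1 p. 4)] -/
def loPat : Fin nm × Finset (Fin nm × Fin nm) := (P.α, withPair P.L₀ P.β P.γ)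
/-- Auxiliary. [cite: KhristoforovSmirnov2021, §2 Lemma 4, proof and Fig. 3 (arXiv v1 p. 4)] -/
def midPat : Fin nm × Finset (Fin nm × Fin nm) := (P.β, withPair P.L₀ P.γ P.α)
/-- Auxiliary. [cite: KhristoforovSmirnov2021, §2 Lemma 4, proof and Fig. 3 (arXiv v1 p. 4)] -/
def hiPat : Fin nm × Finset (Fin nm × Fin nm) := (P.γ, withPair P.L₀ P.α P.β)
/-- the base depth of a picture. [cite: KhristoforovSmirnov2021, §2 Lemma 4, proof and Fig. 3 (arXiv v1 p. 4)] -/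
def pdepth : ℕ := depth P.β P.L₀

/-- the picture's structure. [cite: KhristoforovSmirnov2021, §2 Lemma 4, proof and Fig. 3 (arXiv v1 p. 4)] -/
theorem pic : TripodPicture P.α P.β P.γ P.L₀ := P.2.2.2
/-- Auxiliary. [cite: KhristoforovSmirnov2021, §2 Lemma 4, proof and Fig. 3 (arXiv v1 p. 4)] -/
theorem lt₁ : P.α < P.β := P.2.1
/-- Auxiliary. [cite: KhristoforovSmirnov2021, §2 Lemma 4, proof and Fig. 3 (arXiv v1 p. 4)] -/
theorem lt₂ : P.β < P.γ := P.2.2.1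

/-- depths of the three patterns. [cite: KhristoforovSmirnov2021, §2 Lemma 4, proof and Fig. 3 (p. 4)] -/
theorem depth_midPat : depth P.midPat.1 P.midPat.2 = P.pdepth + 1 := (depth_patterns P.pic P.lt₁ P.lt₂).1
/-- Auxiliary. [cite: KhristoforovSmirnov2021, §2 Lemma 4, proof and Fig. 3 (p. 4)] -/
theorem depth_loPat : depth P.loPat.1 P.loPat.2 = P.pdepth := (depth_patterns P.pic P.lt₁ P.lt₂).2.1
/-- Auxiliary. [cite: KhristoforovSmirnov2021, §2 Lemma 4, proof and Fig. 3 (p. 4)] -/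
theorem depth_hiPat : depth P.hiPat.1 P.hiPat.2 = P.pdepth := (depth_patterns P.pic P.lt₁ P.lt₂).2.2

/-- **the mid pattern determines the picture.** [cite: KhristoforovSmirnov2021, §1.2 (arXiv v1 p. 2)] -/
theorem midPat_injective : Function.Injective (midPat : Pic nm → _) := by
  intro P Q h
  unfold Pic.midPat at h
  obtain ⟨hβ, hL⟩ := Prod.mk.inj h
  have hQ := Q.pic
  have hQ1 := Q.lt₁
  have hQ2 := Q.lt₂
  rw [← hβ] at hQ hQ1 hQ2
  obtain ⟨hα, hγ, hL₀⟩ := midPattern_injective P.pic hQ P.lt₁ P.lt₂ hQ1 hQ2 hL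
  -- assemble the subtype equality
  obtain ⟨⟨⟨a, b, c⟩, L⟩, hp⟩ := P
  obtain ⟨⟨⟨a', b', c'⟩, L'⟩, hq⟩ := Q
  simp only [Pic.α, Pic.β, Pic.γ, Pic.L₀] at hα hβ hγ hL₀
  subst hα; subst hβ; subst hγ; subst hL₀
  rfl

end Pic

/-- the relation vector of a picture. [cite: KhristoforovSmirnov2021, §2 Lemma 4, proof and Fig. 3 (p. 4)] -/
noncomputable def Pic.relVec (P : Pic nm) : (Fin nm × Finset (Fin nm × Fin nm)) → ℂ := tripodRel P.α P.β P.γ P.L₀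

/-- the relation vector evaluated: three indicators. [folklore] -/
private theorem relVec_apply (P : Pic nm) (q : Fin nm × Finset (Fin nm × Fin nm)) :
    P.relVec q = (if q = P.loPat then 1 else 0) + (if q = P.midPat then tau else 0) + (if q = P.hiPat then tau ^ 2 else 0) := by
  unfold Pic.relVec tripodRel Pic.loPat Pic.midPat Pic.hiPat
  rfl

/-- `τ ≠ 0`. [folklore] -/
private theorem tau_ne_zero' : tau ≠ 0 := by unfold tau; exact Complex.exp_ne_zero _

/-- ★★★ **THE TRIPOD RELATIONS ARE LINEARLY INDEPENDENT** (one per picture up to rotation): the solution space of the tripod law has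
codimension exactly the number of pictures. [cite: KhristoforovSmirnov2021, §2 Lemma 4, proof and Fig. 3 (p. 4); §1.2 (p. 2)] -/
theorem linearIndependent_relVec : LinearIndependent ℂ (Pic.relVec : Pic nm → (Fin nm × Finset (Fin nm × Fin nm)) → ℂ) := by
  classical
  rw [linearIndependent_iff']
  intro s g hsum
  by_contra hnot
  obtain ⟨P₁, hP₁⟩ := not_forall.1 hnot
  obtain ⟨hP₁s, hP₁⟩ := Classical.not_imp.1 hP₁
  set t : Finset (Pic nm) := s.filter fun P => g P ≠ 0 with ht
  have htne : t.Nonempty := ⟨P₁, Finset.mem_filter.2 ⟨hP₁s, hP₁⟩⟩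
  obtain ⟨P₀, hP₀t, hmax⟩ := Finset.exists_max_image t Pic.pdepth htne
  obtain ⟨hP₀s, hg₀⟩ := Finset.mem_filter.1 hP₀t
  -- evaluate the vanishing combination at the mid pattern of `P₀`
  have hev := congrFun hsum P₀.midPat
  rw [Finset.sum_apply, Pi.zero_apply] at hev
  simp only [Pi.smul_apply, smul_eq_mul] at hev
  rw [Finset.sum_eq_single P₀] at hev
  · -- the `P₀` term is `g P₀ * τ`
    rw [relVec_apply, if_neg, if_pos rfl, if_neg] at hev
    · simp only [zero_add, add_zero] at hev
      exact hg₀ ((mul_eq_zero.1 hev).resolve_right tau_ne_zero')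
    · intro h
      have := congrArg (fun q : Fin nm × Finset (Fin nm × Fin nm) => depth q.1 q.2) h
      beta_reduce at this
      rw [P₀.depth_midPat, P₀.depth_hiPat] at this
      omega
    · intro h
      have := congrArg (fun q : Fin nm × Finset (Fin nm × Fin nm) => depth q.1 q.2) h
      beta_reduce at this
      rw [P₀.depth_midPat, P₀.depth_loPat] at this
      omega
  · -- every other picture contributes zero at `P₀.midPat`
    intro P hPs hne
    by_cases hgP : g P = 0
    · rw [hgP, zero_mul]
    have hPt : P ∈ t := Finset.mem_filter.2 ⟨hPs, hgP⟩
    have hle := hmax P hPt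
    rw [relVec_apply, if_neg, if_neg, if_neg]
    · ring
    · intro h
      have := congrArg (fun q : Fin nm × Finset (Fin nm × Fin nm) => depth q.1 q.2) h
      beta_reduce at this
      rw [P₀.depth_midPat, P.depth_hiPat] at this
      omega
    · intro h
      exact hne (Pic.midPat_injective h.symm)
    · intro h
      have := congrArg (fun q : Fin nm × Finset (Fin nm × Fin nm) => depth q.1 q.2) h
      beta_reduce at this
      rw [P₀.depth_midPat, P.depth_loPat] at this
      omega
  · intro h; exact absurd hP₀s h

end TripodRankMain

end Literature.Probability.Percolation.MarkedLoops
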